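import Mathlib
import Literature.MathematicalPhysics.QuantumManyBody.PeriodicBoseGas

/-!
# Route BECInfDivCoherence — `LevyMassCondensation`: discrete Fourier analysis on the grid

Helper file (supports `stmt-AtomisticToContinuum-9117`). Pure finite-dimensional facts about the
grid `(ℤ/m)³ = (Fin 3 → Fin m)` and the discrete Lévy weights
`ν_q = m⁻³ Σ_j F(j) cos(2π q·j/m)` of a real grid function `F`:

* `sum_rootOfUnity_pow`, `sum_cos_grid`, `sum_cos_grid_fin` — the roots-of-unity sum
  `Σ_q cos(2π q·n/m) = m³ [m ∣ n]`;
* `sum_levyWeight` — `Σ_q ν_q = F(0)` (total Lévy weight);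
* `sum_levyWeight_mul_cos`, `levyWeight_fsum` — the first trigonometric moment and the discrete
  f-sum `Σ_q ν_q Σ_a (1 - cos(2π q_a/m)) = 3F(0) - Σ_a (F(e_a) + F(-e_a))/2`.

References: Berg–Christensen–Ressel, *Harmonic Analysis on Semigroups* (GTM 100), Ch. 3–4
(Lévy–Khintchine on abelian groups; here only the finite torus `(ℤ/m)³`, proved from scratch).
-/

noncomputable section

namespace Summit.AtomisticToContinuum.BoseEinsteinCondensation.Theorems.InfDivGlue

open Finset Literature.MathematicalPhysics.QuantumManyBody.BoseGas

variable {m : ℕ} [NeZero m]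

/-! ### Roots of unity -/

/-- `Σ_{t < m} ω^t` for `ω = exp(2πi n/m)`: `m` if `m ∣ n`, else `0`. [folklore] -/
theorem sum_rootOfUnity_pow (n : ℤ) :
    ∑ t : Fin m, Complex.exp (2 * Real.pi * Complex.I * n / m) ^ (t : ℕ) =
      if (m : ℤ) ∣ n then (m : ℂ) else 0 := by
  set ω : ℂ := Complex.exp (2 * Real.pi * Complex.I * n / m) with hω
  have hm0 : (m : ℂ) ≠ 0 := Nat.cast_ne_zero.2 (NeZero.ne m)
  have hπI : (2 * Real.pi * Complex.I : ℂ) ≠ 0 := by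
    simp [Real.pi_ne_zero, Complex.I_ne_zero]
  have hωm : ω ^ m = 1 := by
    rw [hω, ← Complex.exp_nat_mul, mul_div_cancel₀ _ hm0,
      show (2 * Real.pi * Complex.I * n : ℂ) = n * (2 * Real.pi * Complex.I) by ring]
    exact Complex.exp_int_mul_two_pi_mul_I n
  rw [Fin.sum_univ_eq_sum_range (fun l => ω ^ l) m]
  split_ifs with hd
  · obtain ⟨z, hz⟩ := hd
    have hω1 : ω = 1 := by
      rw [hω, hz]
      push_cast
      rw [show (2 * Real.pi * Complex.I * (m * z) / m : ℂ) = z * (2 * Real.pi * Complex.I) by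
        field_simp]
      exact Complex.exp_int_mul_two_pi_mul_I z
    simp [hω1]
  · have hω1 : ω ≠ 1 := by
      intro h1
      rw [hω, Complex.exp_eq_one_iff] at h1
      obtain ⟨z, hz⟩ := h1
      apply hd
      refine ⟨z, ?_⟩
      rw [div_eq_iff hm0] at hz
      have h2 : (n : ℂ) = z * m :=
        mul_left_cancel₀ hπI (by rw [hz]; ring)
      have h3 : (n : ℂ) = ((m * z : ℤ) : ℂ) := by rw [h2]; push_cast; ring
      exact_mod_cast h3
    rw [geom_sum_eq hω1, hωm, sub_self, zero_div]

/-- **The roots-of-unity sum on the grid**: `Σ_{q ∈ (ℤ/m)³} cos(2π q·n/m) = m³` if `m ∣ n_k` for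
all `k`, and `0` otherwise. [folklore] -/
theorem sum_cos_grid (n : Fin 3 → ℤ) :
    ∑ q : Fin 3 → Fin m, Real.cos (2 * Real.pi * (∑ k, ((q k : ℕ) : ℝ) * (n k : ℝ)) / m) =
      if ∀ k, (m : ℤ) ∣ n k then (m : ℝ) ^ 3 else 0 := by
  set ω : Fin 3 → ℂ := fun k => Complex.exp (2 * Real.pi * Complex.I * (n k) / m) with hω
  have key : ∀ q : Fin 3 → Fin m,
      Real.cos (2 * Real.pi * (∑ k, ((q k : ℕ) : ℝ) * (n k : ℝ)) / m) =
        (∏ k, ω k ^ (q k : ℕ)).re := by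
    intro q
    rw [← Complex.exp_ofReal_mul_I_re]
    congr 1
    simp_rw [hω, ← Complex.exp_nat_mul, ← Complex.exp_sum]
    congr 1
    push_cast
    rw [Finset.mul_sum, Finset.sum_div, Finset.sum_mul]
    exact Finset.sum_congr rfl fun k _ => by ring
  simp_rw [key]
  rw [← Complex.re_sum, ← Fintype.prod_sum fun k (t : Fin m) => ω k ^ (t : ℕ)]
  simp_rw [hω, sum_rootOfUnity_pow]
  by_cases hall : ∀ k, (m : ℤ) ∣ n k
  · rw [if_pos hall, Finset.prod_congr rfl fun k _ => if_pos (hall k)]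
    simp only [prod_const, card_univ, Fintype.card_fin]
    norm_cast
  · rw [if_neg hall]
    push Not at hall
    obtain ⟨k, hk⟩ := hall
    rw [Finset.prod_eq_zero (Finset.mem_univ k) (if_neg hk), Complex.zero_re]

/-- Grid version: for `j ∈ (Fin m)³`, `Σ_q cos(2π q·j/m) = m³ [j = 0]`. [folklore] -/
theorem sum_cos_grid_fin (j : Fin 3 → Fin m) :
    ∑ q : Fin 3 → Fin m, Real.cos (2 * Real.pi * (∑ k, ((q k : ℕ) : ℝ) * ((j k : ℕ) : ℝ)) / m) =
      if j = 0 then (m : ℝ) ^ 3 else 0 := by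
  have h := sum_cos_grid (m := m) fun k => ((j k : ℕ) : ℤ)
  simp only [Int.cast_natCast] at h
  rw [h]
  congr 1
  apply propext
  constructor
  · intro hd
    funext k
    have hk := hd k
    have hlt : ((j k : ℕ) : ℤ) < m := by exact_mod_cast (j k).isLt
    have h0 := Int.eq_zero_of_dvd_of_nonneg_of_lt (by positivity) hlt hk
    have h0' : j k = 0 := by exact_mod_cast h0
    exact h0'
  · rintro rfl k
    simp

/-! ### The discrete Lévy weights -/

/-- **Total Lévy weight**: `Σ_q ν_q = F(0)`. [folklore] -/
theorem sum_levyWeight (F : (Fin 3 → Fin m) → ℝ) :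
    ∑ q : Fin 3 → Fin m, (∑ j : Fin 3 → Fin m, F j *
      Real.cos (2 * Real.pi * (∑ k, ((q k : ℕ) : ℝ) * ((j k : ℕ) : ℝ)) / m)) / (m : ℝ) ^ 3 = F 0 := by
  have hm0 : (m : ℝ) ^ 3 ≠ 0 := pow_ne_zero _ (Nat.cast_ne_zero.2 (NeZero.ne m))
  rw [← Finset.sum_div, Finset.sum_comm]
  simp_rw [← Finset.mul_sum, sum_cos_grid_fin, mul_ite, mul_zero]
  rw [Finset.sum_ite_eq' Finset.univ (0 : Fin 3 → Fin m)]
  simp [hm0]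

/-- The value of `1 : Fin m` for `m ≥ 2`. [folklore] -/
theorem val_one_of_two_le (hm : 2 ≤ m) : ((1 : Fin m) : ℕ) = 1 := by
  rw [Fin.val_one', Nat.mod_eq_of_lt hm]

/-- The value of `-1 : Fin m` for `m ≥ 2`. [folklore] -/
theorem val_neg_one_of_two_le (hm : 2 ≤ m) : ((-1 : Fin m) : ℕ) = m - 1 := by
  rw [Fin.val_neg', val_one_of_two_le hm, Nat.mod_eq_of_lt (by omega)]

/-- `m ∣ j + e_a` on the grid iff `j = -e_a`. [folklore] -/
theorem dvd_add_single_iff (hm : 2 ≤ m) (j : Fin 3 → Fin m) (a : Fin 3) :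
    (∀ k, (m : ℤ) ∣ ((j k : ℕ) : ℤ) + Pi.single (M := fun _ => ℤ) a 1 k) ↔
      j = Pi.single a (-1) := by
  constructor
  · intro hd
    funext k
    have hk := hd k
    have hlt : ((j k : ℕ) : ℤ) < m := by exact_mod_cast (j k).isLt
    have hnn : (0 : ℤ) ≤ ((j k : ℕ) : ℤ) := by positivity
    by_cases hka : k = a
    · subst hka
      rw [Pi.single_eq_same] at hk
      rw [Pi.single_eq_same]
      have hk' : (m : ℤ) ∣ ((j k : ℕ) : ℤ) + 1 - m := by
        simpa using hk.sub (dvd_refl (m : ℤ))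
      have habs : |((j k : ℕ) : ℤ) + 1 - m| < m := by
        rw [abs_lt]; constructor <;> linarith
      have h0 := Int.eq_zero_of_abs_lt_dvd hk' habs
      apply Fin.ext
      rw [val_neg_one_of_two_le hm]
      omega
    · rw [Pi.single_eq_of_ne hka, add_zero] at hk
      rw [Pi.single_eq_of_ne hka]
      have h0 := Int.eq_zero_of_dvd_of_nonneg_of_lt hnn hlt hk
      exact_mod_cast h0
  · rintro rfl k
    by_cases hka : k = a
    · subst hka
      rw [Pi.single_eq_same, Pi.single_eq_same, val_neg_one_of_two_le hm]
      have : (((m - 1 : ℕ) : ℤ) + 1) = m := by omega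
      rw [this]
    · rw [Pi.single_eq_of_ne hka, Pi.single_eq_of_ne hka]
      simp

/-- `m ∣ j - e_a` on the grid iff `j = e_a`. [folklore] -/
theorem dvd_sub_single_iff (hm : 2 ≤ m) (j : Fin 3 → Fin m) (a : Fin 3) :
    (∀ k, (m : ℤ) ∣ ((j k : ℕ) : ℤ) - Pi.single (M := fun _ => ℤ) a 1 k) ↔
      j = Pi.single a 1 := by
  constructor
  · intro hd
    funext k
    have hk := hd k
    have hlt : ((j k : ℕ) : ℤ) < m := by exact_mod_cast (j k).isLt
    have hnn : (0 : ℤ) ≤ ((j k : ℕ) : ℤ) := by positivity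
    by_cases hka : k = a
    · subst hka
      rw [Pi.single_eq_same] at hk
      rw [Pi.single_eq_same]
      have habs : |((j k : ℕ) : ℤ) - 1| < m := by
        rw [abs_lt]; constructor <;> linarith
      have h0 := Int.eq_zero_of_abs_lt_dvd hk habs
      apply Fin.ext
      rw [val_one_of_two_le hm]
      omega
    · rw [Pi.single_eq_of_ne hka, sub_zero] at hk
      rw [Pi.single_eq_of_ne hka]
      have h0 := Int.eq_zero_of_dvd_of_nonneg_of_lt hnn hlt hk
      exact_mod_cast h0
  · rintro rfl k
    by_cases hka : k = a
    · subst hka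
      rw [Pi.single_eq_same, Pi.single_eq_same, val_one_of_two_le hm]
      simp
    · rw [Pi.single_eq_of_ne hka, Pi.single_eq_of_ne hka]
      simp

/-- **First trigonometric moment of the Lévy weights**:
`Σ_q ν_q cos(2π q_a/m) = (F(e_a) + F(-e_a))/2`. [folklore] -/
theorem sum_levyWeight_mul_cos (hm : 2 ≤ m) (F : (Fin 3 → Fin m) → ℝ) (a : Fin 3) :
    ∑ q : Fin 3 → Fin m, (∑ j : Fin 3 → Fin m, F j *
      Real.cos (2 * Real.pi * (∑ k, ((q k : ℕ) : ℝ) * ((j k : ℕ) : ℝ)) / m)) / (m : ℝ) ^ 3 *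
      Real.cos (2 * Real.pi * ((q a : ℕ) : ℝ) / m) =
    (F (Pi.single a 1) + F (Pi.single a (-1))) / 2 := by
  have hm0 : (m : ℝ) ^ 3 ≠ 0 := pow_ne_zero _ (Nat.cast_ne_zero.2 (NeZero.ne m))
  -- the integer vectors `j ± e_a`
  set np : (Fin 3 → Fin m) → Fin 3 → ℤ := fun j k =>
    ((j k : ℕ) : ℤ) + Pi.single (M := fun _ => ℤ) a 1 k with hnp
  set nm : (Fin 3 → Fin m) → Fin 3 → ℤ := fun j k =>
    ((j k : ℕ) : ℤ) - Pi.single (M := fun _ => ℤ) a 1 k with hnm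
  -- product-to-sum
  have hps : ∀ q j : Fin 3 → Fin m,
      Real.cos (2 * Real.pi * (∑ k, ((q k : ℕ) : ℝ) * ((j k : ℕ) : ℝ)) / m) *
        Real.cos (2 * Real.pi * ((q a : ℕ) : ℝ) / m) =
      (Real.cos (2 * Real.pi * (∑ k, ((q k : ℕ) : ℝ) * (np j k : ℝ)) / m) +
        Real.cos (2 * Real.pi * (∑ k, ((q k : ℕ) : ℝ) * (nm j k : ℝ)) / m)) / 2 := by
    intro q j
    have hsum1 : ∑ k, ((q k : ℕ) : ℝ) * (np j k : ℝ) =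
        ∑ k, ((q k : ℕ) : ℝ) * ((j k : ℕ) : ℝ) + ((q a : ℕ) : ℝ) := by
      simp only [hnp, Int.cast_add, Int.cast_natCast, mul_add, Finset.sum_add_distrib]
      congr 1
      rw [Finset.sum_eq_single a (fun k _ hk => by rw [Pi.single_eq_of_ne hk]; simp)
        (fun h => absurd (Finset.mem_univ a) h), Pi.single_eq_same]
      simp
    have hsum2 : ∑ k, ((q k : ℕ) : ℝ) * (nm j k : ℝ) =
        ∑ k, ((q k : ℕ) : ℝ) * ((j k : ℕ) : ℝ) - ((q a : ℕ) : ℝ) := by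
      simp only [hnm, Int.cast_sub, Int.cast_natCast, mul_sub, Finset.sum_sub_distrib]
      congr 1
      rw [Finset.sum_eq_single a (fun k _ hk => by rw [Pi.single_eq_of_ne hk]; simp)
        (fun h => absurd (Finset.mem_univ a) h), Pi.single_eq_same]
      simp
    rw [hsum1, hsum2]
    set S : ℝ := ∑ k, ((q k : ℕ) : ℝ) * ((j k : ℕ) : ℝ) with hS
    have e1 : 2 * Real.pi * (S + ((q a : ℕ) : ℝ)) / m =
        2 * Real.pi * S / m + 2 * Real.pi * ((q a : ℕ) : ℝ) / m := by ring
    have e2 : 2 * Real.pi * (S - ((q a : ℕ) : ℝ)) / m =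
        2 * Real.pi * S / m - 2 * Real.pi * ((q a : ℕ) : ℝ) / m := by ring
    rw [e1, e2, Real.cos_add, Real.cos_sub]
    ring
  have hps' : ∀ q j : Fin 3 → Fin m,
      F j * Real.cos (2 * Real.pi * (∑ k, ((q k : ℕ) : ℝ) * ((j k : ℕ) : ℝ)) / m) *
        Real.cos (2 * Real.pi * ((q a : ℕ) : ℝ) / m) =
      F j * ((Real.cos (2 * Real.pi * (∑ k, ((q k : ℕ) : ℝ) * (np j k : ℝ)) / m) +
        Real.cos (2 * Real.pi * (∑ k, ((q k : ℕ) : ℝ) * (nm j k : ℝ)) / m)) / 2) := by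
    intro q j
    rw [mul_assoc, hps]
  calc ∑ q : Fin 3 → Fin m, (∑ j : Fin 3 → Fin m, F j *
        Real.cos (2 * Real.pi * (∑ k, ((q k : ℕ) : ℝ) * ((j k : ℕ) : ℝ)) / m)) / (m : ℝ) ^ 3 *
        Real.cos (2 * Real.pi * ((q a : ℕ) : ℝ) / m)
      = (∑ j : Fin 3 → Fin m, F j * ∑ q : Fin 3 → Fin m,
          (Real.cos (2 * Real.pi * (∑ k, ((q k : ℕ) : ℝ) * (np j k : ℝ)) / m) +
            Real.cos (2 * Real.pi * (∑ k, ((q k : ℕ) : ℝ) * (nm j k : ℝ)) / m)) / 2) /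
          (m : ℝ) ^ 3 := by
        simp_rw [div_mul_eq_mul_div, Finset.sum_mul, hps']
        rw [← Finset.sum_div, Finset.sum_comm]
        simp_rw [← Finset.mul_sum]
    _ = (∑ j : Fin 3 → Fin m, F j *
          (((if j = Pi.single a (-1) then (m : ℝ) ^ 3 else 0) +
            (if j = Pi.single a 1 then (m : ℝ) ^ 3 else 0)) / 2)) / (m : ℝ) ^ 3 := by
        congr 1
        refine Finset.sum_congr rfl fun j _ => ?_
        congr 1
        rw [← Finset.sum_div, Finset.sum_add_distrib, sum_cos_grid, sum_cos_grid]
        congr 3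
        · exact propext (dvd_add_single_iff hm j a)
        · exact propext (dvd_sub_single_iff hm j a)
    _ = (F (Pi.single a 1) + F (Pi.single a (-1))) / 2 := by
        have hsum : ∀ α : Fin 3 → Fin m,
            ∑ j : Fin 3 → Fin m, F j * (if j = α then (m : ℝ) ^ 3 else 0) = F α * (m : ℝ) ^ 3 := by
          intro α
          simp_rw [mul_ite, mul_zero]
          rw [Finset.sum_ite_eq']
          simp
        have hre : ∑ j : Fin 3 → Fin m, F j *
            (((if j = Pi.single a (-1) then (m : ℝ) ^ 3 else 0) +
              (if j = Pi.single a 1 then (m : ℝ) ^ 3 else 0)) / 2) =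
            (∑ j : Fin 3 → Fin m, F j * (if j = Pi.single a (-1) then (m : ℝ) ^ 3 else 0) +
              ∑ j : Fin 3 → Fin m, F j * (if j = Pi.single a 1 then (m : ℝ) ^ 3 else 0)) / 2 := by
          rw [← Finset.sum_add_distrib, Finset.sum_div]
          exact Finset.sum_congr rfl fun j _ => by ring
        rw [hre, hsum, hsum]
        field_simp
        ring

/-- **The discrete f-sum identity**:
`Σ_q ν_q Σ_a (1 - cos(2π q_a/m)) = 3 F(0) - Σ_a (F(e_a) + F(-e_a))/2`. [folklore] -/
theorem levyWeight_fsum (hm : 2 ≤ m) (F : (Fin 3 → Fin m) → ℝ) :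
    ∑ q : Fin 3 → Fin m, (∑ j : Fin 3 → Fin m, F j *
      Real.cos (2 * Real.pi * (∑ k, ((q k : ℕ) : ℝ) * ((j k : ℕ) : ℝ)) / m)) / (m : ℝ) ^ 3 *
      (∑ a, (1 - Real.cos (2 * Real.pi * ((q a : ℕ) : ℝ) / m))) =
    3 * F 0 - ∑ a : Fin 3, (F (Pi.single a 1) + F (Pi.single a (-1))) / 2 := by
  set ν : (Fin 3 → Fin m) → ℝ := fun q => (∑ j : Fin 3 → Fin m, F j *
      Real.cos (2 * Real.pi * (∑ k, ((q k : ℕ) : ℝ) * ((j k : ℕ) : ℝ)) / m)) / (m : ℝ) ^ 3 with hν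
  have h1 : ∑ q, ν q = F 0 := sum_levyWeight F
  have h2 : ∀ a : Fin 3, ∑ q, ν q * Real.cos (2 * Real.pi * ((q a : ℕ) : ℝ) / m) =
      (F (Pi.single a 1) + F (Pi.single a (-1))) / 2 := fun a => sum_levyWeight_mul_cos hm F a
  show ∑ q : Fin 3 → Fin m, ν q * (∑ a, (1 - Real.cos (2 * Real.pi * ((q a : ℕ) : ℝ) / m))) = _
  simp_rw [Finset.mul_sum, mul_sub, mul_one]
  rw [Finset.sum_comm]
  have hin : ∀ a : Fin 3, ∑ q : Fin 3 → Fin m, (ν q - ν q * Real.cos (2 * Real.pi * ((q a : ℕ) : ℝ) / m)) =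
      F 0 - (F (Pi.single a 1) + F (Pi.single a (-1))) / 2 := by
    intro a
    rw [Finset.sum_sub_distrib, h1, h2]
  rw [Finset.sum_congr rfl fun a _ => hin a, Finset.sum_sub_distrib, Finset.sum_const,
    Finset.card_univ, Fintype.card_fin]
  simp only [nsmul_eq_mul, Nat.cast_ofNat]

end Summit.AtomisticToContinuum.BoseEinsteinCondensation.Theorems.InfDivGlue

end
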